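import Mathlib
import HarnessLib
import Summits.ValiantsHypothesis.ValiantsHypothesis.Theorems.LacunarySymmetroidMatrixDescartesProductPlusOneBalanceZone

/-!
# ValiantsHypothesis / LacunarySymmetroid — crux `MatrixDescartes` (stmt-ValiantsHypothesis-18050, V1),
# LINE (A) «product_plus_one», floor `OneChangeFloorK3`: LINEAR COUNT OUTSIDE THE BALANCE ZONE (every support ratio)

Sequel of ✓ `…ProductPlusOneBalanceZone` (window laws) — here the windows are summed into COUNTS in the stub's own currency
(`Z₊` of the unfolded `eulerNumerator d a 0`, linear in `m`), by the fibre count of ✓ `euler_pos_roots_le` run on an order-connected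
set of the half-line instead of all of `(0,∞)`:

* `roots_filter_le_of_windowLaw` — GENERIC: `P ≠ 0`, `E` real polynomials, `p` an order-connected predicate on `ℝ`; if `P` has at most `B`
  roots in `p` and `E` has no two roots `w₁ < w₂` in `p` spanning a `P`-zero-free window, then `E` has at most `B + (B+1)` roots in `p`;
* ★ `euler_roots_beyond_balance_le` — a NO-DIP company (`a_{j0} a_{j2} < 0`; the floor's incoherent `(+,−,−)` and coherent `(+,+,−)` types,
  degenerate middle letters allowed), bottom coupling, ANY support `d 0 < d 1 < d 2`, and a height `U > 0` beyond every row's balance point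
  (`(d₂−d₀−3(d₁−d₀))·a_{j1}a_{j2} ≤ (d₁−d₀)·a_{j2}²·U^{d₂−d₁}`): `#{roots of eulerNumerator d a 0 in [U,∞)} ≤ 2m + 1`;
* ★ `euler_roots_before_balance_le` — the mirror: `V` before every balance point
  (`(d₂−d₀)(d₂−d₀−3(d₁−d₀))·a_{j1}a_{j2}·V^{d₂−d₁} ≤ (d₁−d₀)²·a_{j1}²`): `#{roots in (0,V]} ≤ 2m + 1`.

At ratio `d₂−d₀ ≤ 3(d₁−d₀)` both hypotheses are empty (`U`, `V` arbitrary) and either theorem is the tame count; at ratio `> 4` they say the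
c-free Euler count of a no-dip company is LINEAR IN `m` OUTSIDE THE BALANCE ZONE `(V, U)` — the floor's open core (`T5` rows at ratio `> 4`)
lives entirely inside the zone `x^{d₂−d₁} ∈ (min_j p²|a_{j1}|/(q(q−3p)|a_{j2}|), max_j (q−3p)|a_{j1}|/(p|a_{j2}|))`, `p = d₁−d₀`, `q = d₂−d₀`.
HONEST FRAMING: a localisation/count cell of the research floor; NOT `OneChangeFloorK3` / `stub_eulerBoundK3` / `stub_classRowK3` /
`stub_polyLaw` / `MatrixDescartes`; `VP ≠ VNP` is NOT proved.  No definitions, no named facts; Mathlib + the lane files.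
-/

set_option linter.dupNamespace false

namespace Summit.ValiantsHypothesis.ValiantsHypothesis.Theorems.LacunarySymmetroidMatrixDescartes

namespace ProductPlusOne

open Polynomial Finset
open scoped BigOperators

/-! ### §1 Generic fibre count on an order-connected predicate -/

/-- **Generic window-to-count lemma.**  `P ≠ 0` and `E` real polynomials, `p` a decidable ORDER-CONNECTED predicate; if `P` has at most `B`
roots satisfying `p`, and `E` has no two roots `w₁ < w₂` satisfying `p` with `P` zero-free on `[w₁,w₂]`, then `E` has at most `B + (B + 1)` roots
satisfying `p` (roots of `P`, plus one per zero-free component). [folklore; fibre count of ✓ `euler_pos_roots_le`] -/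
theorem roots_filter_le_of_windowLaw (P E : ℝ[X]) (hP0 : P ≠ 0) (p : ℝ → Prop) [DecidablePred p]
    (hp : ∀ z₁ z₂ t : ℝ, p z₁ → p z₂ → z₁ ≤ t → t ≤ z₂ → p t) (B : ℕ)
    (hZ : (P.roots.toFinset.filter p).card ≤ B)
    (hwin : ∀ w₁ w₂ : ℝ, p w₁ → p w₂ → w₁ < w₂ → (∀ t ∈ Set.Icc w₁ w₂, eval t P ≠ 0) →
      eval w₁ E = 0 → eval w₂ E = 0 → False) :
    (E.roots.toFinset.filter p).card ≤ B + (B + 1) := by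
  classical
  set Zp := P.roots.toFinset.filter p with hZp
  set S := E.roots.toFinset.filter p with hSdef
  by_cases hE0 : E = 0
  · have : S = ∅ := by rw [hSdef, hE0, roots_zero, Multiset.toFinset_zero, Finset.filter_empty]
    rw [this, Finset.card_empty]; exact Nat.zero_le _
  have hSmem : ∀ z ∈ S, p z ∧ eval z E = 0 := by
    intro z hz
    rw [hSdef, mem_filter, Multiset.mem_toFinset, mem_roots hE0] at hz
    exact ⟨hz.2, hz.1⟩
  set S₁ := S.filter (fun z => eval z P = 0) with hS₁
  set S₂ := S.filter (fun z => eval z P ≠ 0) with hS₂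
  have hsplit : S.card = S₁.card + S₂.card := by
    rw [hS₁, hS₂]; exact (Finset.card_filter_add_card_filter_not _).symm
  have hS₁le : S₁.card ≤ B := by
    refine le_trans (card_le_card fun z hz => ?_) hZ
    rw [hS₁, mem_filter] at hz
    rw [mem_filter, Multiset.mem_toFinset, mem_roots hP0]
    exact ⟨hz.2, (hSmem z hz.1).1⟩
  -- two points of `S₂` with the same number of `P`-roots (in `p`) below them span a zero-free window
  have hfree : ∀ z₁ ∈ S₂, ∀ z₃ ∈ S₂, z₁ < z₃ →
      (Zp.filter (fun t => t < z₁)).card = (Zp.filter (fun t => t < z₃)).card →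
      ∀ t ∈ Set.Icc z₁ z₃, eval t P ≠ 0 := by
    intro z₁ hz₁ z₃ hz₃ h13 hk13 t ht hPt
    rw [hS₂, mem_filter] at hz₁ hz₃
    rcases eq_or_lt_of_le ht.1 with h1 | h1
    · exact hz₁.2 (h1 ▸ hPt)
    rcases eq_or_lt_of_le ht.2 with h | h
    · exact hz₃.2 (h ▸ hPt)
    have htZ : t ∈ Zp := by
      rw [hZp, mem_filter, Multiset.mem_toFinset, mem_roots hP0]
      exact ⟨hPt, hp z₁ z₃ t (hSmem z₁ hz₁.1).1 (hSmem z₃ hz₃.1).1 ht.1 ht.2⟩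
    have hsub : Zp.filter (fun s => s < z₁) ⊆ Zp.filter (fun s => s < z₃) := by
      intro s hs
      rw [mem_filter] at hs ⊢
      exact ⟨hs.1, hs.2.trans h13⟩
    have hstrict : Zp.filter (fun s => s < z₁) ⊂ Zp.filter (fun s => s < z₃) := by
      refine Finset.ssubset_iff_subset_ne.mpr ⟨hsub, fun heq => ?_⟩
      have ht1 : t ∈ Zp.filter (fun s => s < z₁) := by
        rw [heq, mem_filter]
        exact ⟨htZ, h⟩
      rw [mem_filter] at ht1
      exact absurd ht1.2 (not_lt.mpr ht.1)
    exact absurd hk13 (Finset.card_lt_card hstrict).ne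
  have hfiber : ∀ v ∈ S₂.image (fun z => (Zp.filter (fun t => t < z)).card),
      (S₂.filter (fun z => (Zp.filter (fun t => t < z)).card = v)).card ≤ 1 := by
    intro v _
    rw [Finset.card_le_one]
    intro z₁ hz₁ z₂ hz₂
    rw [mem_filter] at hz₁ hz₂
    by_contra hne
    have hp₁ : p z₁ := by have h := hz₁.1; rw [hS₂, mem_filter] at h; exact (hSmem z₁ h.1).1
    have hp₂ : p z₂ := by have h := hz₂.1; rw [hS₂, mem_filter] at h; exact (hSmem z₂ h.1).1
    have hE₁ : eval z₁ E = 0 := by have h := hz₁.1; rw [hS₂, mem_filter] at h; exact (hSmem z₁ h.1).2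
    have hE₂ : eval z₂ E = 0 := by have h := hz₂.1; rw [hS₂, mem_filter] at h; exact (hSmem z₂ h.1).2
    rcases lt_or_gt_of_ne hne with h12 | h21
    · exact hwin z₁ z₂ hp₁ hp₂ h12 (hfree z₁ hz₁.1 z₂ hz₂.1 h12 (hz₁.2.trans hz₂.2.symm)) hE₁ hE₂
    · exact hwin z₂ z₁ hp₂ hp₁ h21 (hfree z₂ hz₂.1 z₁ hz₁.1 h21 (hz₂.2.trans hz₁.2.symm)) hE₂ hE₁
  have himg : S₂.image (fun z => (Zp.filter (fun t => t < z)).card) ⊆ Finset.range (B + 1) := by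
    intro v hv
    rw [Finset.mem_image] at hv
    obtain ⟨z, _, rfl⟩ := hv
    rw [Finset.mem_range]
    exact Nat.lt_succ_of_le ((Finset.card_filter_le _ _).trans hZ)
  have hS₂le : S₂.card ≤ B + 1 :=
    calc S₂.card = ∑ v ∈ S₂.image (fun z => (Zp.filter (fun t => t < z)).card),
          (S₂.filter (fun z => (Zp.filter (fun t => t < z)).card = v)).card :=
          Finset.card_eq_sum_card_image _ S₂
      _ ≤ ∑ _v ∈ S₂.image (fun z => (Zp.filter (fun t => t < z)).card), 1 := Finset.sum_le_sum hfiber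
      _ = (S₂.image (fun z => (Zp.filter (fun t => t < z)).card)).card := by
          rw [Finset.sum_const, smul_eq_mul, mul_one]
      _ ≤ B + 1 := (Finset.card_le_card himg).trans (by rw [Finset.card_range])
  rw [hsplit]
  exact Nat.add_le_add hS₁le hS₂le

/-! ### §2 The no-dip company outside its balance zone -/

/-- Roots of `X^n · E` satisfying a predicate that forces `t ≠ 0` are roots of `E` (as a card inequality). [folklore] -/
theorem card_roots_X_pow_mul_filter_le (n : ℕ) (E : ℝ[X]) (p : ℝ → Prop) [DecidablePred p] (hp : ∀ t, p t → t ≠ 0) :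
    (((X : ℝ[X]) ^ n * E).roots.toFinset.filter p).card ≤ (E.roots.toFinset.filter p).card := by
  classical
  by_cases hE : E = 0
  · rw [hE, mul_zero]
  refine card_le_card fun t ht => ?_
  rw [mem_filter, Multiset.mem_toFinset] at ht ⊢
  have h0 : (X : ℝ[X]) ^ n * E ≠ 0 := mul_ne_zero (pow_ne_zero _ X_ne_zero) hE
  have hr := (mem_roots h0).mp ht.1
  rw [IsRoot.def, eval_mul, eval_pow, eval_X] at hr
  refine ⟨(mem_roots hE).mpr ?_, ht.2⟩
  rcases mul_eq_zero.mp hr with h | h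
  · exact absurd (pow_eq_zero_iff'.mp h).1 (hp t ht.2)
  · exact h

/-- The window law of ✓ `…BalanceZone` in the shape `roots_filter_le_of_windowLaw` wants: no-dip company, top-dominated at the left end
of the window. [this file's lemma] -/
theorem windowLaw_topDominated {m : ℕ} (hm : 0 < m) (a b c : Fin m → ℝ) (e k : ℕ) (hac : ∀ j, a j * c j < 0)
    {w₁ w₂ : ℝ} (hw₁ : 0 < w₁) (hw : w₁ < w₂)
    (hdom : ∀ j, ((e + k + 2 : ℝ) - 3 * (e + 1 : ℝ)) * (b j * c j) ≤ (e + 1 : ℝ) * c j ^ 2 * w₁ ^ (k + 1))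
    (hfree : ∀ t ∈ Set.Icc w₁ w₂, eval t (∏ j, (C (a j) + C (b j) * X ^ (e + 1) + C (c j) * X ^ (e + k + 2))) ≠ 0)
    (h1 : eval w₁ (X * derivative (∏ j, (C (a j) + C (b j) * X ^ (e + 1) + C (c j) * X ^ (e + k + 2)))) = 0)
    (h2 : eval w₂ (X * derivative (∏ j, (C (a j) + C (b j) * X ^ (e + 1) + C (c j) * X ^ (e + k + 2)))) = 0) : False := by
  have hfree' : ∀ t ∈ Set.Icc w₁ w₂, ∀ j, a j + b j * t ^ (e + 1) + c j * t ^ (e + k + 2) ≠ 0 := by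
    intro t ht j hj
    apply hfree t ht
    rw [eval_prod_trinomial, Finset.prod_eq_zero_iff]
    exact ⟨j, mem_univ _, hj⟩
  refine X_mul_derivative_no_two_zeros_of_rows' hm a b c e k hw₁ hw hfree' (fun t ht j => Or.inr ⟨hac j, ?_⟩) h1 h2
  right; right; left
  exact topDominated_mono _ _ (b j) (c j) (k + 1) (by positivity) hw₁.le ht.1 (hdom j)

/-- The mirror: middle-dominated at the right end of the window. [this file's lemma] -/
theorem windowLaw_middleDominated {m : ℕ} (hm : 0 < m) (a b c : Fin m → ℝ) (e k : ℕ) (hac : ∀ j, a j * c j < 0)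
    {w₁ w₂ : ℝ} (hw₁ : 0 < w₁) (hw : w₁ < w₂)
    (hdom : ∀ j, (e + k + 2 : ℝ) * ((e + k + 2 : ℝ) - 3 * (e + 1 : ℝ)) * (b j * c j) * w₂ ^ (k + 1) ≤ (e + 1 : ℝ) ^ 2 * b j ^ 2)
    (hfree : ∀ t ∈ Set.Icc w₁ w₂, eval t (∏ j, (C (a j) + C (b j) * X ^ (e + 1) + C (c j) * X ^ (e + k + 2))) ≠ 0)
    (h1 : eval w₁ (X * derivative (∏ j, (C (a j) + C (b j) * X ^ (e + 1) + C (c j) * X ^ (e + k + 2)))) = 0)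
    (h2 : eval w₂ (X * derivative (∏ j, (C (a j) + C (b j) * X ^ (e + 1) + C (c j) * X ^ (e + k + 2)))) = 0) : False := by
  have hfree' : ∀ t ∈ Set.Icc w₁ w₂, ∀ j, a j + b j * t ^ (e + 1) + c j * t ^ (e + k + 2) ≠ 0 := by
    intro t ht j hj
    apply hfree t ht
    rw [eval_prod_trinomial, Finset.prod_eq_zero_iff]
    exact ⟨j, mem_univ _, hj⟩
  refine X_mul_derivative_no_two_zeros_of_rows' hm a b c e k hw₁ hw hfree' (fun t ht j => Or.inr ⟨hac j, ?_⟩) h1 h2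
  right; right; right
  have e2 : (e + k + 2 : ℝ) * ((e + k + 2 : ℝ) - 3 * (e + 1 : ℝ)) * (b j * c j) * w₂ ^ (k + 1)
      = ((e + k + 2 : ℝ) * ((e + k + 2 : ℝ) - 3 * (e + 1 : ℝ))) * (b j * c j) * w₂ ^ (k + 1) := by ring
  have e1 : (e + k + 2 : ℝ) * ((e + k + 2 : ℝ) - 3 * (e + 1 : ℝ)) * (b j * c j) * t ^ (k + 1)
      = ((e + k + 2 : ℝ) * ((e + k + 2 : ℝ) - 3 * (e + 1 : ℝ))) * (b j * c j) * t ^ (k + 1) := by ring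
  rw [e1]
  exact middleDominated_anti _ _ (b j) (c j) (k + 1) (by positivity) (hw₁.le.trans ht.1) ht.2 (e2 ▸ hdom j)

/-- ★ **LINEAR COUNT BEYOND THE BALANCE ZONE** (no-dip company `a_{j0} a_{j2} < 0`, bottom coupling, ANY support `d 0 < d 1 < d 2`, any `m`):
if `U > 0` lies beyond every row's balance point, `(d₂−d₀−3(d₁−d₀))·a_{j1}a_{j2} ≤ (d₁−d₀)·a_{j2}²·U^{d₂−d₁}` for every row (empty at
ratio `d₂−d₀ ≤ 3(d₁−d₀)`), then `eulerNumerator d a 0` has at most `2m + 1` roots in `[U, ∞)` — whatever the phases of the rows there. [this file's theorem] -/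
theorem euler_roots_beyond_balance_le {m : ℕ} (d : Fin 3 → ℕ) (h01 : d 0 < d 1) (h12 : d 1 < d 2)
    (a : Fin m → Fin 3 → ℝ) (hac : ∀ j, a j 0 * a j 2 < 0) {U : ℝ} (hU : 0 < U)
    (hbal : ∀ j, (((d 2 : ℝ) - d 0) - 3 * ((d 1 : ℝ) - d 0)) * (a j 1 * a j 2) ≤ ((d 1 : ℝ) - d 0) * a j 2 ^ 2 * U ^ (d 2 - d 1)) :
    ((∑ j, (∑ l, C (a j l * ((d l : ℝ) - d 0)) * X ^ (d l)) * ∏ i ∈ Finset.univ.erase j, (∑ l, C (a i l) * X ^ (d l))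
        : ℝ[X]).roots.toFinset.filter (fun t => U ≤ t)).card ≤ 2 * m + 1 := by
  classical
  rcases Nat.eq_zero_or_pos m with hm | hm
  · subst hm
    simp only [Finset.univ_eq_empty, Finset.sum_empty, roots_zero, Multiset.toFinset_zero, Finset.filter_empty,
      Finset.card_empty]
    exact Nat.zero_le _
  obtain ⟨e, he⟩ : ∃ e, d 1 = d 0 + e + 1 := ⟨d 1 - d 0 - 1, by omega⟩
  obtain ⟨k, hk⟩ : ∃ k, d 2 = d 0 + e + k + 2 := ⟨d 2 - d 1 - 1, by omega⟩
  have hk1 : d 2 - d 1 = k + 1 := by omega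
  have hp : ((d 1 : ℝ) - d 0) = (e + 1 : ℝ) := by rw [he]; push_cast; ring
  have hq : ((d 2 : ℝ) - d 0) = (e + k + 2 : ℝ) := by rw [hk]; push_cast; ring
  rw [eulerNumerator_eq d e k he hk a 0, sub_self, mul_zero, map_zero, zero_mul, sub_zero]
  set P : ℝ[X] := ∏ j, (C (a j 0) + C (a j 1) * X ^ (e + 1) + C (a j 2) * X ^ (e + k + 2)) with hPdef
  have hac' : ∀ j, a j 0 * a j 2 < 0 := hac
  have hP0 : P ≠ 0 := prod_trinomial_ne_zero (fun j => a j 0) (fun j => a j 1) (fun j => a j 2) e k hac'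
  refine (card_roots_X_pow_mul_filter_le (m * d 0) (X * derivative P) (fun t => U ≤ t) (fun t ht => (hU.trans_le ht).ne')).trans ?_
  have hZ : (P.roots.toFinset.filter (fun t => U ≤ t)).card ≤ m := by
    refine le_trans (card_le_card fun t ht => ?_)
      (prod_trinomial_pos_roots_le (fun j => a j 0) (fun j => a j 1) (fun j => a j 2) e k hac')
    rw [mem_filter] at ht ⊢
    exact ⟨ht.1, hU.trans_le ht.2⟩
  have hdom : ∀ j, ((e + k + 2 : ℝ) - 3 * (e + 1 : ℝ)) * (a j 1 * a j 2) ≤ (e + 1 : ℝ) * a j 2 ^ 2 * U ^ (k + 1) := by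
    intro j
    have h := hbal j
    rw [hp, hq, hk1] at h
    exact h
  have h := roots_filter_le_of_windowLaw P (X * derivative P) hP0 (fun t => U ≤ t)
    (fun z₁ z₂ t h₁ _ h₂ _ => h₁.trans h₂) m hZ (fun w₁ w₂ hw₁ _ hw hfree h1 h2 =>
      windowLaw_topDominated hm (fun j => a j 0) (fun j => a j 1) (fun j => a j 2) e k hac' (hU.trans_le hw₁) hw
        (fun j => topDominated_mono _ _ (a j 1) (a j 2) (k + 1) (by positivity) hU.le hw₁ (hdom j)) hfree h1 h2)
  exact h.trans (by omega)

/-- ★ **LINEAR COUNT BEFORE THE BALANCE ZONE** (no-dip company, bottom coupling, ANY support): if `V` lies before every row's balance point,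
`(d₂−d₀)(d₂−d₀−3(d₁−d₀))·a_{j1}a_{j2}·V^{d₂−d₁} ≤ (d₁−d₀)²·a_{j1}²` for every row, then `eulerNumerator d a 0` has at most `2m + 1` roots in
`(0, V]`. [this file's theorem] -/
theorem euler_roots_before_balance_le {m : ℕ} (d : Fin 3 → ℕ) (h01 : d 0 < d 1) (h12 : d 1 < d 2)
    (a : Fin m → Fin 3 → ℝ) (hac : ∀ j, a j 0 * a j 2 < 0) {V : ℝ}
    (hbal : ∀ j, ((d 2 : ℝ) - d 0) * (((d 2 : ℝ) - d 0) - 3 * ((d 1 : ℝ) - d 0)) * (a j 1 * a j 2) * V ^ (d 2 - d 1)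
      ≤ ((d 1 : ℝ) - d 0) ^ 2 * a j 1 ^ 2) :
    ((∑ j, (∑ l, C (a j l * ((d l : ℝ) - d 0)) * X ^ (d l)) * ∏ i ∈ Finset.univ.erase j, (∑ l, C (a i l) * X ^ (d l))
        : ℝ[X]).roots.toFinset.filter (fun t => 0 < t ∧ t ≤ V)).card ≤ 2 * m + 1 := by
  classical
  rcases Nat.eq_zero_or_pos m with hm | hm
  · subst hm
    simp only [Finset.univ_eq_empty, Finset.sum_empty, roots_zero, Multiset.toFinset_zero, Finset.filter_empty,
      Finset.card_empty]
    exact Nat.zero_le _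
  obtain ⟨e, he⟩ : ∃ e, d 1 = d 0 + e + 1 := ⟨d 1 - d 0 - 1, by omega⟩
  obtain ⟨k, hk⟩ : ∃ k, d 2 = d 0 + e + k + 2 := ⟨d 2 - d 1 - 1, by omega⟩
  have hk1 : d 2 - d 1 = k + 1 := by omega
  have hp : ((d 1 : ℝ) - d 0) = (e + 1 : ℝ) := by rw [he]; push_cast; ring
  have hq : ((d 2 : ℝ) - d 0) = (e + k + 2 : ℝ) := by rw [hk]; push_cast; ring
  rw [eulerNumerator_eq d e k he hk a 0, sub_self, mul_zero, map_zero, zero_mul, sub_zero]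
  set P : ℝ[X] := ∏ j, (C (a j 0) + C (a j 1) * X ^ (e + 1) + C (a j 2) * X ^ (e + k + 2)) with hPdef
  have hac' : ∀ j, a j 0 * a j 2 < 0 := hac
  have hP0 : P ≠ 0 := prod_trinomial_ne_zero (fun j => a j 0) (fun j => a j 1) (fun j => a j 2) e k hac'
  refine (card_roots_X_pow_mul_filter_le (m * d 0) (X * derivative P) (fun t => 0 < t ∧ t ≤ V) (fun t ht => ht.1.ne')).trans ?_
  have hZ : (P.roots.toFinset.filter (fun t => 0 < t ∧ t ≤ V)).card ≤ m := by
    refine le_trans (card_le_card fun t ht => ?_)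
      (prod_trinomial_pos_roots_le (fun j => a j 0) (fun j => a j 1) (fun j => a j 2) e k hac')
    rw [mem_filter] at ht ⊢
    exact ⟨ht.1, ht.2.1⟩
  have hdom : ∀ j, (e + k + 2 : ℝ) * ((e + k + 2 : ℝ) - 3 * (e + 1 : ℝ)) * (a j 1 * a j 2) * V ^ (k + 1)
      ≤ (e + 1 : ℝ) ^ 2 * a j 1 ^ 2 := by
    intro j
    have h := hbal j
    rw [hp, hq, hk1] at h
    exact h
  have h := roots_filter_le_of_windowLaw P (X * derivative P) hP0 (fun t => 0 < t ∧ t ≤ V)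
    (fun z₁ z₂ t h₁ h₂ h₃ h₄ => ⟨h₁.1.trans_le h₃, h₄.trans h₂.2⟩) m hZ (fun w₁ w₂ hw₁ hw₂ hw hfree h1 h2 =>
      windowLaw_middleDominated hm (fun j => a j 0) (fun j => a j 1) (fun j => a j 2) e k hac' hw₁.1 hw
        (fun j => ?_) hfree h1 h2)
  · exact h.trans (by omega)
  · have e2 : (e + k + 2 : ℝ) * ((e + k + 2 : ℝ) - 3 * (e + 1 : ℝ)) * (a j 1 * a j 2) * V ^ (k + 1)
        = ((e + k + 2 : ℝ) * ((e + k + 2 : ℝ) - 3 * (e + 1 : ℝ))) * (a j 1 * a j 2) * V ^ (k + 1) := by ring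
    have e1 : (e + k + 2 : ℝ) * ((e + k + 2 : ℝ) - 3 * (e + 1 : ℝ)) * (a j 1 * a j 2) * w₂ ^ (k + 1)
        = ((e + k + 2 : ℝ) * ((e + k + 2 : ℝ) - 3 * (e + 1 : ℝ))) * (a j 1 * a j 2) * w₂ ^ (k + 1) := by ring
    rw [e1]
    exact middleDominated_anti _ _ (a j 1) (a j 2) (k + 1) (by positivity) (hw₁.1.le.trans hw.le) hw₂.2 (e2 ▸ hdom j)

end ProductPlusOne

end Summit.ValiantsHypothesis.ValiantsHypothesis.Theorems.LacunarySymmetroidMatrixDescartes
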